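import Literature.Analysis.SpecialFunctions.HypergeometricQuadraticGauss
import Mathlib.Analysis.ODE.Gronwall
import Mathlib.Analysis.Calculus.Deriv.Prod
import Mathlib.Analysis.SpecialFunctions.Pow.Continuity
import Mathlib.Tactic.Linarith
import Mathlib.Tactic.Positivity
import Mathlib.Tactic.FieldSimp
import Mathlib.Tactic.Ring
import Mathlib.Tactic.LinearCombination
import HarnessLib

/-!
# Gauss's quadratic transformation for EVERY real `a` (`b > 0`, `0 < x < 1`): the identification by uniqueness for the regular linear system

M. Swathi, A. K. Rathie, R. B. Paris, arXiv:1411.5262 (2014), §1 eq. (1.1): `(1+x)^{-2a} ₂F₁(a, b; 2b; 4x/(1+x)²) =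
₂F₁(a, a−b+½; b+½; x²)`, «provided 2b is neither zero nor a negative integer» — no sign condition on `a`; §2 derives it from
Rainville's equation (2.1)–(2.3). Part 2 (`HypergeometricQuadraticGauss`) proved it for Mathlib's REAL `ordinaryHypergeometric`
when `0 ≤ a` (`0 < b`, `0 < x < 1`), the Frobenius step replaced by Abel's identity plus POSITIVITY of `W = ₂F₁(a,b;2b;·)` (which is
what `a ≥ 0` buys). This file (part 3 of 3) removes the sign condition: for `a < 0` the Wronskian still vanishes on `(0,1)` (Abel's
identity and `x^{2b} → 0` need only `b > 0`), `W → 1` at `0⁺` makes `W > 0` on some `(0, δ)`, so `W₂ = W` there exactly as in part 2,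
and the identity is propagated to all of `(0,1)` by UNIQUENESS for the regular first-order system `(w, w′)′ = (w′, (4(1−t)ab·w −
2(1+t)(b − 2at + (b−1)t²)·w′)/(t(1−t)(1+t)²))` on compact subintervals `[α, β] ⊂ (0,1)`, where its right-hand side is Lipschitz with
an explicit constant (Mathlib's `ODE_solution_unique_of_mem_Ioo`).

* `gaussQuadratic_wronskian_eq_zero` — `W·W₂′ − W′·W₂ = 0` on `(0,1)` for `b > 0` and every real `a`;
* `gaussQuadratic_eqOn_near_zero` — for `b > 0` there is `δ ∈ (0,1)` with `W₂ = W` on `(0, δ)`;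
* **`ordinaryHypergeometric_gauss_quadratic_real`** — `₂F₁(a,b;2b;4x/(1+x)²) = (1+x)^{2a}·₂F₁(a, a−b+½; b+½; x²)` for all real
  `a`, `0 < b`, `0 < x < 1`; `ordinaryHypergeometric_gauss_quadratic_real'` — the printed `(1+x)^{−2a}` form.

NOT claimed: `b ≤ 0`; `x ≤ 0`, `x ≥ 1`; complex `x`; the contiguous transformations (1.2)–(1.3); Kummer's and the other quadratic
transformations; connection formulae.

## References
* [SwathiRathieParis2014] M. Swathi, A. K. Rathie, R. B. Paris, arXiv:1411.5262, §1 eq. (1.1), §2 eq. (2.1)–(2.3).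
* [AndrewsAskeyRoy1999] G. E. Andrews, R. Askey, R. Roy, *Special Functions*, CUP 1999, §3.1 (3.1.11).
-/

noncomputable section

open Set Filter Topology Metric

namespace Literature.Analysis.SpecialFunctions.Hypergeometric

open Literature.NumberTheory.Automorphic.LegendreP (hasDerivAt_ordinaryHypergeometric hasSum_ordinaryHypergeometric)

/-- **The Wronskian of the two sides vanishes on `(0,1)`** for `b > 0` and EVERY real `a`: with `W(x) = ₂F₁(a,b;2b;4x/(1+x)²)` and
`W₂(x) = (1+x)^{2a}₂F₁(a,a−b+½;b+½;x²)`, `W·W₂′ − W′·W₂ = 0` on `(0,1)` — Abel's identity (`hasDerivAt_gaussQuadratic_wronskian`, part 1)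
makes `Z = x^{2b}(1−x)^{1+2a−2b}(1+x)^{1−2a−2b}·(W W₂′ − W′ W₂)` constant, and `Z → 0` at `0⁺` because `x^{2b} → 0` while the other
factors have finite limits (the step of part 2, which uses `b > 0` only). [cite: SwathiRathieParis2014, §2 eq. (2.1)] -/
theorem gaussQuadratic_wronskian_eq_zero {a b : ℝ} (hb : 0 < b) {x : ℝ} (hx : x ∈ Ioo (0 : ℝ) 1) :
    ordinaryHypergeometric a b (2 * b) (4 * x / (1 + x) ^ 2) *
        deriv (fun r : ℝ => (1 + r) ^ (2 * a) * ordinaryHypergeometric a (a - b + 1 / 2) (b + 1 / 2) (r ^ 2)) x -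
      deriv (fun r : ℝ => ordinaryHypergeometric a b (2 * b) (4 * r / (1 + r) ^ 2)) x *
        ((1 + x) ^ (2 * a) * ordinaryHypergeometric a (a - b + 1 / 2) (b + 1 / 2) (x ^ 2)) = 0 := by
  set Yf : ℝ → ℝ := fun r => ordinaryHypergeometric a b (2 * b) (4 * r / (1 + r) ^ 2) with hYf
  set Vf : ℝ → ℝ := fun r => (1 + r) ^ (2 * a) * ordinaryHypergeometric a (a - b + 1 / 2) (b + 1 / 2) (r ^ 2)
    with hVf
  set Y₁ : ℝ → ℝ := fun r => a * b / (2 * b) *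
    ordinaryHypergeometric (a + 1) (b + 1) (2 * b + 1) (4 * r / (1 + r) ^ 2) * (4 * (1 - r) / (1 + r) ^ 3) with hY₁
  set V₁ : ℝ → ℝ := fun r => 2 * a * (1 + r) ^ (2 * a - 1) * ordinaryHypergeometric a (a - b + 1 / 2) (b + 1 / 2) (r ^ 2) +
    (1 + r) ^ (2 * a) * (a * (a - b + 1 / 2) / (b + 1 / 2) *
      ordinaryHypergeometric (a + 1) (a - b + 1 / 2 + 1) (b + 1 / 2 + 1) (r ^ 2) * (2 * r)) with hV₁
  have hdY : ∀ r ∈ Ioo (0 : ℝ) 1, deriv Yf r = Y₁ r := fun r hr => (gaussQuadraticLeft_deriv_data a b hr).1.deriv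
  have hdV : ∀ r ∈ Ioo (0 : ℝ) 1, deriv Vf r = V₁ r := fun r hr => (gaussQuadraticRight_deriv_data a b hr).1.deriv
  set Z : ℝ → ℝ := fun r => r ^ (2 * b) * (1 - r) ^ (1 + 2 * a - 2 * b) * (1 + r) ^ (1 - 2 * a - 2 * b) *
    (Yf r * deriv Vf r - deriv Yf r * Vf r) with hZ
  have hZc : ∀ r ∈ Ioo (0 : ℝ) 1, Z r = Z (1 / 2) := fun r hr =>
    IsOpen.is_const_of_deriv_eq_zero isOpen_Ioo (convex_Ioo (0 : ℝ) 1).isPreconnected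
      (fun y hy => (hasDerivAt_gaussQuadratic_wronskian (a := a) hb hy).differentiableAt.differentiableWithinAt)
      (fun y hy => (hasDerivAt_gaussQuadratic_wronskian (a := a) hb hy).deriv) hr ⟨by norm_num, by norm_num⟩
  have hz0 : ContinuousAt (fun r : ℝ => 4 * r / (1 + r) ^ 2) 0 :=
    ((continuousAt_const.mul continuousAt_id).div ((continuousAt_const.add continuousAt_id).pow 2) (by norm_num))
  have hF0 : ∀ a' b' c' : ℝ, ContinuousAt (fun r : ℝ => ordinaryHypergeometric a' b' c' (4 * r / (1 + r) ^ 2)) 0 := by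
    intro a' b' c'
    have hc : ContinuousAt (ordinaryHypergeometric a' b' c') (4 * (0 : ℝ) / (1 + 0) ^ 2) :=
      (hasDerivAt_ordinaryHypergeometric (a := a') (b := b') (c := c') (by norm_num)).continuousAt
    exact ContinuousAt.comp (g := ordinaryHypergeometric a' b' c') hc hz0
  have hG0 : ∀ a' b' c' : ℝ, ContinuousAt (fun r : ℝ => ordinaryHypergeometric a' b' c' (r ^ 2)) 0 := by
    intro a' b' c'
    have hc : ContinuousAt (ordinaryHypergeometric a' b' c') ((0 : ℝ) ^ 2) :=
      (hasDerivAt_ordinaryHypergeometric (a := a') (b := b') (c := c') (by norm_num)).continuousAt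
    exact ContinuousAt.comp (g := ordinaryHypergeometric a' b' c') hc (continuousAt_id.pow 2)
  have hP0 : ∀ p : ℝ, ContinuousAt (fun r : ℝ => (1 + r) ^ p) 0 := fun p =>
    (continuousAt_const.add continuousAt_id).rpow_const (Or.inl (by norm_num))
  have hM0 : ∀ p : ℝ, ContinuousAt (fun r : ℝ => (1 - r) ^ p) 0 := fun p =>
    (continuousAt_const.sub continuousAt_id).rpow_const (Or.inl (by norm_num))
  have hYc : ContinuousAt Yf 0 := hF0 a b (2 * b)
  have hVc : ContinuousAt Vf 0 := (hP0 (2 * a)).mul (hG0 a (a - b + 1 / 2) (b + 1 / 2))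
  have hY₁c : ContinuousAt Y₁ 0 :=
    ((continuousAt_const.mul (hF0 (a + 1) (b + 1) (2 * b + 1))).mul
      ((continuousAt_const.mul (continuousAt_const.sub continuousAt_id)).div
        ((continuousAt_const.add continuousAt_id).pow 3) (by norm_num)))
  have hV₁c : ContinuousAt V₁ 0 :=
    ((continuousAt_const.mul (hP0 (2 * a - 1))).mul (hG0 a (a - b + 1 / 2) (b + 1 / 2))).add
      ((hP0 (2 * a)).mul ((continuousAt_const.mul (hG0 (a + 1) (a - b + 1 / 2 + 1) (b + 1 / 2 + 1))).mul
        (continuousAt_const.mul continuousAt_id)))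
  have hIoo : Ioo (0 : ℝ) 1 ∈ 𝓝[>] (0 : ℝ) := Ioo_mem_nhdsGT (by norm_num)
  have hM : Tendsto (fun r => (1 - r) ^ (1 + 2 * a - 2 * b) * (1 + r) ^ (1 - 2 * a - 2 * b) *
      (Yf r * deriv Vf r - deriv Yf r * Vf r)) (𝓝[>] 0)
      (𝓝 ((1 - 0) ^ (1 + 2 * a - 2 * b) * (1 + 0) ^ (1 - 2 * a - 2 * b) * (Yf 0 * V₁ 0 - Y₁ 0 * Vf 0))) := by
    have hc : ContinuousAt (fun r => (1 - r) ^ (1 + 2 * a - 2 * b) * (1 + r) ^ (1 - 2 * a - 2 * b) *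
        (Yf r * V₁ r - Y₁ r * Vf r)) 0 :=
      ((hM0 (1 + 2 * a - 2 * b)).mul (hP0 (1 - 2 * a - 2 * b))).mul ((hYc.mul hV₁c).sub (hY₁c.mul hVc))
    refine (hc.tendsto.mono_left nhdsWithin_le_nhds).congr' ?_
    filter_upwards [hIoo] with r hr
    simp only [hdY r hr, hdV r hr]
  have hρpow : Tendsto (fun r : ℝ => r ^ (2 * b)) (𝓝[>] 0) (𝓝 0) := by
    have hc := (Real.continuousAt_rpow_const 0 (2 * b) (Or.inr (by positivity))).tendsto
    rw [Real.zero_rpow (by positivity)] at hc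
    exact hc.mono_left nhdsWithin_le_nhds
  have hZ0 : Tendsto Z (𝓝[>] 0) (𝓝 0) := by
    have h := hρpow.mul hM
    rw [zero_mul] at h
    refine h.congr' (Eventually.of_forall fun r => ?_)
    simp only [hZ]; ring
  have hZhalf : Z (1 / 2) = 0 := by
    have hlim : Tendsto Z (𝓝[>] 0) (𝓝 (Z (1 / 2))) := by
      refine tendsto_const_nhds.congr' ?_
      filter_upwards [hIoo] with r hr
      exact (hZc r hr).symm
    exact tendsto_nhds_unique hlim hZ0
  have hz := hZc x hx
  rw [hZhalf] at hz
  have hw : x ^ (2 * b) * (1 - x) ^ (1 + 2 * a - 2 * b) * (1 + x) ^ (1 - 2 * a - 2 * b) ≠ 0 := by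
    have h1 : 0 < x ^ (2 * b) := Real.rpow_pos_of_pos hx.1 _
    have h2 : 0 < (1 - x) ^ (1 + 2 * a - 2 * b) := Real.rpow_pos_of_pos (by linarith [hx.2]) _
    have h3 : 0 < (1 + x) ^ (1 - 2 * a - 2 * b) := Real.rpow_pos_of_pos (by linarith [hx.1]) _
    positivity
  exact (mul_eq_zero.mp hz).resolve_left hw

/-- **Local identification near the singular point.** For `b > 0` (any real `a`) there is `δ ∈ (0,1)` with `W₂ = W` on `(0,δ)`:
`W = ₂F₁(a,b;2b;4x/(1+x)²) → 1` at `0⁺`, so `W > 0` on some `(0,δ)`; there `W₂/W` has zero derivative (the Wronskian vanishes,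
`gaussQuadratic_wronskian_eq_zero`) and tends to `W₂(0)/W(0) = 1`. [cite: SwathiRathieParis2014, §2] -/
theorem gaussQuadratic_eqOn_near_zero {a b : ℝ} (hb : 0 < b) :
    ∃ δ : ℝ, 0 < δ ∧ δ < 1 ∧ ∀ x ∈ Ioo (0 : ℝ) δ,
      ordinaryHypergeometric a b (2 * b) (4 * x / (1 + x) ^ 2) =
        (1 + x) ^ (2 * a) * ordinaryHypergeometric a (a - b + 1 / 2) (b + 1 / 2) (x ^ 2) := by
  set Yf : ℝ → ℝ := fun r => ordinaryHypergeometric a b (2 * b) (4 * r / (1 + r) ^ 2) with hYf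
  set Vf : ℝ → ℝ := fun r => (1 + r) ^ (2 * a) * ordinaryHypergeometric a (a - b + 1 / 2) (b + 1 / 2) (r ^ 2)
    with hVf
  have hz0 : ContinuousAt (fun r : ℝ => 4 * r / (1 + r) ^ 2) 0 :=
    ((continuousAt_const.mul continuousAt_id).div ((continuousAt_const.add continuousAt_id).pow 2) (by norm_num))
  have hYc : ContinuousAt Yf 0 := by
    have hc : ContinuousAt (ordinaryHypergeometric a b (2 * b)) (4 * (0 : ℝ) / (1 + 0) ^ 2) :=
      (hasDerivAt_ordinaryHypergeometric (a := a) (b := b) (c := 2 * b) (by norm_num)).continuousAt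
    exact ContinuousAt.comp (g := ordinaryHypergeometric a b (2 * b)) hc hz0
  have hVc : ContinuousAt Vf 0 := by
    have hc : ContinuousAt (ordinaryHypergeometric a (a - b + 1 / 2) (b + 1 / 2)) ((0 : ℝ) ^ 2) :=
      (hasDerivAt_ordinaryHypergeometric (a := a) (b := a - b + 1 / 2) (c := b + 1 / 2) (by norm_num)).continuousAt
    exact ((continuousAt_const.add continuousAt_id).rpow_const (Or.inl (by norm_num))).mul
      (ContinuousAt.comp (g := ordinaryHypergeometric a (a - b + 1 / 2) (b + 1 / 2)) hc (continuousAt_id.pow 2))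
  have hY0 : Yf 0 = 1 := by simp [hYf]
  have hV0 : Vf 0 = 1 := by simp [hVf]
  -- `W > 1/2` on a neighbourhood of `0`
  obtain ⟨δ₀, hδ₀, hball⟩ := Metric.continuousAt_iff.mp hYc (1 / 2) (by norm_num)
  set δ := min δ₀ (1 / 2) with hδ
  have hδpos : 0 < δ := lt_min hδ₀ (by norm_num)
  have hδ1 : δ < 1 := lt_of_le_of_lt (min_le_right _ _) (by norm_num)
  have hYpos : ∀ r ∈ Ioo (0 : ℝ) δ, 0 < Yf r := by
    intro r hr
    have hr' : dist r 0 < δ₀ := by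
      rw [Real.dist_eq, sub_zero, abs_of_pos hr.1]; exact lt_of_lt_of_le hr.2 (min_le_left _ _)
    have h := hball hr'
    rw [hY0, Real.dist_eq, abs_lt] at h
    linarith [h.1]
  have hsub : ∀ r ∈ Ioo (0 : ℝ) δ, r ∈ Ioo (0 : ℝ) 1 := fun r hr => ⟨hr.1, hr.2.trans hδ1⟩
  -- the ratio `Vf/Yf` is constant on `(0,δ)`
  have hquot : ∀ r ∈ Ioo (0 : ℝ) δ, HasDerivAt (fun y => Vf y / Yf y) 0 r := by
    intro r hr
    obtain ⟨hY, -⟩ := gaussQuadraticLeft_deriv_data a b (hsub r hr)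
    obtain ⟨hV, -⟩ := gaussQuadraticRight_deriv_data a b (hsub r hr)
    have hYd : HasDerivAt Yf (deriv Yf r) r := hY.differentiableAt.hasDerivAt
    have hVd : HasDerivAt Vf (deriv Vf r) r := hV.differentiableAt.hasDerivAt
    refine ((hVd.div hYd (hYpos r hr).ne')).congr_deriv ?_
    rw [div_eq_zero_iff]
    left
    linear_combination gaussQuadratic_wronskian_eq_zero (a := a) hb (hsub r hr)
  obtain ⟨c, hc⟩ := IsOpen.exists_is_const_of_deriv_eq_zero (f := fun y => Vf y / Yf y)
    isOpen_Ioo (convex_Ioo (0 : ℝ) δ).isPreconnected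
    (fun y hy => (hquot y hy).differentiableAt.differentiableWithinAt)
    (fun y hy => (hquot y hy).deriv)
  have hIoo : Ioo (0 : ℝ) δ ∈ 𝓝[>] (0 : ℝ) := Ioo_mem_nhdsGT hδpos
  have hc1 : c = 1 := by
    have hlim : Tendsto (fun y => Vf y / Yf y) (𝓝[>] 0) (𝓝 (Vf 0 / Yf 0)) :=
      ((hVc.div hYc (by rw [hY0]; norm_num)).tendsto).mono_left nhdsWithin_le_nhds
    rw [hY0, hV0, div_one] at hlim
    have hlim' : Tendsto (fun y => Vf y / Yf y) (𝓝[>] 0) (𝓝 c) := by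
      refine tendsto_const_nhds.congr' ?_
      filter_upwards [hIoo] with y hy
      exact (hc y hy).symm
    exact tendsto_nhds_unique hlim' hlim
  refine ⟨δ, hδpos, hδ1, fun x hx => ?_⟩
  have h := hc x hx
  rw [hc1, div_eq_one_iff_eq (hYpos x hx).ne'] at h
  simpa [hYf, hVf] using h.symm

/-- **Gauss's quadratic transformation for every real `a`** (`0 < b`, `0 < x < 1`):
`₂F₁(a, b; 2b; 4x/(1+x)²) = (1+x)^{2a} · ₂F₁(a, a−b+½; b+½; x²)`. PROOF: both sides `W`, `W₂` solve the regular linear equation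
(2.1) on `(0,1)` (part 1), agree on some `(0,δ)` (`gaussQuadratic_eqOn_near_zero`), hence have the same Cauchy data `(w, w′)` at
`t₀ = δ/2`; the pair `(w, w′)` solves the first-order system `y′ = (y₂, (4(1−t)ab·y₁ − 2(1+t)(b − 2at + (b−1)t²)·y₂)/(t(1−t)(1+t)²))`,
whose right-hand side is Lipschitz in `y` on `[α, β] ⊂ (0,1)` with the explicit constant `1 + (4|a||b| + 4(2|b| + 2|a| + 1))/(α(1−β))`,
so Mathlib's `ODE_solution_unique_of_mem_Ioo` gives `W = W₂` on `(α, β) ∋ x`. [cite: SwathiRathieParis2014, §1 eq. (1.1)] -/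
theorem ordinaryHypergeometric_gauss_quadratic_real (a : ℝ) {b : ℝ} (hb : 0 < b) {x : ℝ} (hx : x ∈ Ioo (0 : ℝ) 1) :
    ordinaryHypergeometric a b (2 * b) (4 * x / (1 + x) ^ 2) =
      (1 + x) ^ (2 * a) * ordinaryHypergeometric a (a - b + 1 / 2) (b + 1 / 2) (x ^ 2) := by
  obtain ⟨δ, hδ0, hδ1, hloc⟩ := gaussQuadratic_eqOn_near_zero (a := a) hb
  rcases lt_or_ge x δ with hxδ | hxδ
  · exact hloc x ⟨hx.1, hxδ⟩
  set Yf : ℝ → ℝ := fun r => ordinaryHypergeometric a b (2 * b) (4 * r / (1 + r) ^ 2) with hYf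
  set Vf : ℝ → ℝ := fun r => (1 + r) ^ (2 * a) * ordinaryHypergeometric a (a - b + 1 / 2) (b + 1 / 2) (r ^ 2)
    with hVf
  -- the interval `(α, β)` with `α = δ/4 < t₀ = δ/2 < δ ≤ x < β = (1+x)/2 < 1`
  set α : ℝ := δ / 4 with hα
  set β : ℝ := (1 + x) / 2 with hβ
  set t₀ : ℝ := δ / 2 with ht₀def
  have hα0 : 0 < α := by positivity
  have hβ1 : β < 1 := by rw [hβ]; linarith [hx.2]
  have hαβ : ∀ t ∈ Ioo α β, t ∈ Ioo (0 : ℝ) 1 := fun t ht => ⟨hα0.trans ht.1, ht.2.trans hβ1⟩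
  have ht₀ : t₀ ∈ Ioo α β := ⟨by rw [hα, ht₀def]; linarith, by rw [hβ, ht₀def]; linarith [hx.1]⟩
  have hxI : x ∈ Ioo α β := ⟨by rw [hα]; linarith, by rw [hβ]; linarith [hx.2]⟩
  -- the vector field of the first-order system and its Lipschitz constant on `(α, β)`
  set P : ℝ → ℝ := fun t => t * (1 - t) * (1 + t) ^ 2 with hP
  set Q : ℝ → ℝ := fun t => 2 * (1 + t) * (b - 2 * a * t + (b - 1) * t ^ 2) with hQ
  set R : ℝ → ℝ := fun t => 4 * (1 - t) * a * b with hR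
  set v : ℝ → ℝ × ℝ → ℝ × ℝ := fun t y => (y.2, (R t * y.1 - Q t * y.2) / P t) with hv
  set M : ℝ := 4 * |a| * |b| + 4 * (2 * |b| + 2 * |a| + 1) with hM
  have hM0 : 0 ≤ M := by positivity
  have hK0 : 0 ≤ 1 + M / (α * (1 - β)) := by
    have : 0 < α * (1 - β) := mul_pos hα0 (by linarith)
    positivity
  set K : NNReal := ⟨1 + M / (α * (1 - β)), hK0⟩ with hK
  have hPpos : ∀ t ∈ Ioo α β, α * (1 - β) ≤ P t ∧ 0 < P t := by
    intro t ht
    have h1 : α ≤ t := ht.1.le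
    have h2 : 1 - β ≤ 1 - t := by linarith [ht.2]
    have h3 : (1 : ℝ) ≤ (1 + t) ^ 2 := by nlinarith [hα0, ht.1]
    have h4 : 0 < 1 - β := by linarith
    have hprod : α * (1 - β) ≤ t * (1 - t) := mul_le_mul h1 h2 h4.le (hα0.le.trans h1)
    have ht0 : 0 ≤ t * (1 - t) := (mul_pos hα0 h4).le.trans hprod
    constructor
    · calc α * (1 - β) ≤ t * (1 - t) := hprod
        _ = t * (1 - t) * 1 := (mul_one _).symm
        _ ≤ t * (1 - t) * (1 + t) ^ 2 := mul_le_mul_of_nonneg_left h3 ht0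
    · exact lt_of_lt_of_le (mul_pos hα0 h4) (le_trans (le_trans hprod (by rw [mul_one])) (mul_le_mul_of_nonneg_left h3 ht0))
  have hQb : ∀ t ∈ Ioo α β, |Q t| ≤ 4 * (2 * |b| + 2 * |a| + 1) := by
    intro t ht
    have ht1 : t ∈ Ioo (0 : ℝ) 1 := hαβ t ht
    have h1 : |2 * (1 + t)| ≤ 4 := by rw [abs_of_pos (by linarith [ht1.1])]; linarith [ht1.2]
    have h2 : |b - 2 * a * t + (b - 1) * t ^ 2| ≤ 2 * |b| + 2 * |a| + 1 := by
      have ht2 : |t| ≤ 1 := by rw [abs_of_pos ht1.1]; exact ht1.2.le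
      have htsq : |t ^ 2| ≤ 1 := by rw [abs_of_nonneg (sq_nonneg t)]; nlinarith [ht1.1, ht1.2]
      calc |b - 2 * a * t + (b - 1) * t ^ 2| ≤ |b - 2 * a * t| + |(b - 1) * t ^ 2| := abs_add_le _ _
        _ ≤ (|b| + |2 * a * t|) + |b - 1| * |t ^ 2| := by
            rw [abs_mul (b - 1)]; linarith [abs_sub b (2 * a * t)]
        _ ≤ (|b| + 2 * |a| * 1) + (|b| + 1) * 1 := by
            have e1 : |2 * a * t| = 2 * |a| * |t| := by rw [abs_mul, abs_mul, abs_two]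
            rw [e1]
            have hb1 : |b - 1| ≤ |b| + 1 := by
              calc |b - 1| ≤ |b| + |(1 : ℝ)| := abs_sub b 1
                _ = |b| + 1 := by rw [abs_one]
            have h3 : |b - 1| * |t ^ 2| ≤ (|b| + 1) * 1 := mul_le_mul hb1 htsq (abs_nonneg _) (by positivity)
            have h4 : 2 * |a| * |t| ≤ 2 * |a| * 1 := mul_le_mul_of_nonneg_left ht2 (by positivity)
            linarith
        _ = 2 * |b| + 2 * |a| + 1 := by ring
    calc |Q t| = |2 * (1 + t)| * |b - 2 * a * t + (b - 1) * t ^ 2| := by rw [hQ]; exact abs_mul _ _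
      _ ≤ 4 * (2 * |b| + 2 * |a| + 1) := mul_le_mul h1 h2 (abs_nonneg _) (by norm_num)
  have hRb : ∀ t ∈ Ioo α β, |R t| ≤ 4 * |a| * |b| := by
    intro t ht
    have ht1 : t ∈ Ioo (0 : ℝ) 1 := hαβ t ht
    have h1 : |4 * (1 - t)| ≤ 4 := by rw [abs_of_pos (by linarith [ht1.2])]; linarith [ht1.1]
    calc |R t| = |4 * (1 - t)| * |a| * |b| := by rw [hR]; simp only [abs_mul]
      _ ≤ 4 * |a| * |b| := by
          have := mul_le_mul_of_nonneg_right (mul_le_mul_of_nonneg_right h1 (abs_nonneg a)) (abs_nonneg b)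
          exact this
  have hLip : ∀ t ∈ Ioo α β, LipschitzOnWith K (v t) univ := by
    intro t ht
    rw [lipschitzOnWith_univ]
    refine LipschitzWith.of_dist_le_mul fun y y' => ?_
    obtain ⟨hPl, hPp⟩ := hPpos t ht
    have hd1 : |y.1 - y'.1| ≤ dist y y' := by rw [← Real.dist_eq, Prod.dist_eq]; exact le_max_left _ _
    have hd2 : |y.2 - y'.2| ≤ dist y y' := by rw [← Real.dist_eq, Prod.dist_eq]; exact le_max_right _ _
    have hdist : 0 ≤ dist y y' := dist_nonneg
    have hcoef : (|R t| + |Q t|) / P t ≤ M / (α * (1 - β)) := by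
      have hnum : |R t| + |Q t| ≤ M := by rw [hM]; linarith [hQb t ht, hRb t ht]
      exact div_le_div₀ hM0 hnum (mul_pos hα0 (by linarith)) hPl
    have h2 : |(R t * y.1 - Q t * y.2) / P t - (R t * y'.1 - Q t * y'.2) / P t| ≤ M / (α * (1 - β)) * dist y y' := by
      rw [← sub_div, abs_div, abs_of_pos hPp, div_le_iff₀ hPp]
      have e : R t * y.1 - Q t * y.2 - (R t * y'.1 - Q t * y'.2) = R t * (y.1 - y'.1) - Q t * (y.2 - y'.2) := by ring
      rw [e]
      calc |R t * (y.1 - y'.1) - Q t * (y.2 - y'.2)| ≤ |R t * (y.1 - y'.1)| + |Q t * (y.2 - y'.2)| :=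
            abs_sub (R t * (y.1 - y'.1)) (Q t * (y.2 - y'.2))
        _ = |R t| * |y.1 - y'.1| + |Q t| * |y.2 - y'.2| := by rw [abs_mul (R t), abs_mul (Q t)]
        _ ≤ |R t| * dist y y' + |Q t| * dist y y' :=
            add_le_add (mul_le_mul_of_nonneg_left hd1 (abs_nonneg _)) (mul_le_mul_of_nonneg_left hd2 (abs_nonneg _))
        _ = (|R t| + |Q t|) / P t * dist y y' * P t := by field_simp
        _ ≤ M / (α * (1 - β)) * dist y y' * P t :=
            mul_le_mul_of_nonneg_right (mul_le_mul_of_nonneg_right hcoef hdist) hPp.le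
    rw [Prod.dist_eq, Real.dist_eq, Real.dist_eq]
    have hK' : (K : ℝ) = 1 + M / (α * (1 - β)) := rfl
    rw [hK']
    have hMc : 0 ≤ M / (α * (1 - β)) := div_nonneg hM0 (mul_pos hα0 (by linarith)).le
    refine max_le ?_ ?_
    · simp only [hv]
      nlinarith [hd2, hMc, hdist]
    · simp only [hv]
      nlinarith [h2, hdist]
  -- both sides solve the system on `(α, β)`
  have hsolY : ∀ t ∈ Ioo α β, HasDerivAt (fun r => (Yf r, deriv Yf r)) (v t (Yf t, deriv Yf t)) t ∧
      (Yf t, deriv Yf t) ∈ (univ : Set (ℝ × ℝ)) := by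
    intro t ht
    have ht1 := hαβ t ht
    obtain ⟨hY, hY'⟩ := gaussQuadraticLeft_deriv_data a b ht1
    have hYd : HasDerivAt Yf (deriv Yf t) t := hY.differentiableAt.hasDerivAt
    have hY'd : HasDerivAt (deriv Yf) (deriv (deriv Yf) t) t := hY'.differentiableAt.hasDerivAt
    have hode := gaussQuadraticLeft_ode (a := a) hb ht1
    have hPne : P t ≠ 0 := (hPpos t ht).2.ne'
    have e : deriv (deriv Yf) t = (R t * Yf t - Q t * deriv Yf t) / P t := by
      rw [eq_div_iff hPne]
      simp only [hP, hQ, hR]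
      linear_combination hode
    refine ⟨?_, mem_univ _⟩
    have h := hYd.prodMk hY'd
    rw [e] at h
    exact h
  have hsolV : ∀ t ∈ Ioo α β, HasDerivAt (fun r => (Vf r, deriv Vf r)) (v t (Vf t, deriv Vf t)) t ∧
      (Vf t, deriv Vf t) ∈ (univ : Set (ℝ × ℝ)) := by
    intro t ht
    have ht1 := hαβ t ht
    obtain ⟨hV, hV'⟩ := gaussQuadraticRight_deriv_data a b ht1
    have hVd : HasDerivAt Vf (deriv Vf t) t := hV.differentiableAt.hasDerivAt
    have hV'd : HasDerivAt (deriv Vf) (deriv (deriv Vf) t) t := hV'.differentiableAt.hasDerivAt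
    have hode := gaussQuadraticRight_ode (a := a) hb ht1
    have hPne : P t ≠ 0 := (hPpos t ht).2.ne'
    have e : deriv (deriv Vf) t = (R t * Vf t - Q t * deriv Vf t) / P t := by
      rw [eq_div_iff hPne]
      simp only [hP, hQ, hR]
      linear_combination hode
    refine ⟨?_, mem_univ _⟩
    have h := hVd.prodMk hV'd
    rw [e] at h
    exact h
  -- equal Cauchy data at `t₀ ∈ (0, δ)`
  have ht₀0 : 0 < t₀ := by rw [ht₀def]; linarith
  have ht₀δ : t₀ < δ := by rw [ht₀def]; linarith
  have hnear : Ioo (0 : ℝ) δ ∈ 𝓝 t₀ := Ioo_mem_nhds ht₀0 ht₀δ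
  have hEq : Yf =ᶠ[𝓝 t₀] Vf := by
    filter_upwards [hnear] with r hr
    exact hloc r hr
  have h0 : Yf t₀ = Vf t₀ := hloc t₀ ⟨ht₀0, ht₀δ⟩
  have heq0 : (Yf t₀, deriv Yf t₀) = (Vf t₀, deriv Vf t₀) := by
    rw [h0, hEq.deriv_eq]
  have hE := ODE_solution_unique_of_mem_Ioo (v := v) (s := fun _ => (univ : Set (ℝ × ℝ))) (K := K) hLip ht₀
    hsolY hsolV heq0 hxI
  simpa [hYf, hVf] using congrArg Prod.fst hE

/-- **Gauss's quadratic transformation in the printed form** (arXiv:1411.5262 eq. (1.1)) for every real `a`, `0 < b`, `0 < x < 1`: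
`(1+x)^{−2a} · ₂F₁(a, b; 2b; 4x/(1+x)²) = ₂F₁(a, a−b+½; b+½; x²)`. [cite: SwathiRathieParis2014, §1 eq. (1.1)] -/
theorem ordinaryHypergeometric_gauss_quadratic_real' (a : ℝ) {b : ℝ} (hb : 0 < b) {x : ℝ} (hx : x ∈ Ioo (0 : ℝ) 1) :
    (1 + x) ^ (-(2 * a)) * ordinaryHypergeometric a b (2 * b) (4 * x / (1 + x) ^ 2) =
      ordinaryHypergeometric a (a - b + 1 / 2) (b + 1 / 2) (x ^ 2) := by
  have h1 : (0 : ℝ) < 1 + x := by linarith [hx.1]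
  rw [ordinaryHypergeometric_gauss_quadratic_real a hb hx, ← mul_assoc, ← Real.rpow_add h1, neg_add_cancel,
    Real.rpow_zero, one_mul]

end Literature.Analysis.SpecialFunctions.Hypergeometric

end
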